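import Summits.AtomisticToContinuum.Crystallization.Theorems.FreeSplittingCertificatesRadiusLadderStars

/-!
# `ApproxFiniteRangeSplitting` (stmt-AtomisticToContinuum-12562): the `ε`-ladder at pair radii

Companion of `FreeSplittingCertificatesRadiusLadder` / `…RadiusLadderStars` (block-2b unit `b2b-freesplit-A`,
gen 4).  VALUE = theorems / kernel-checked certificates about what the lj-lp star certificates decide for the
`ε`-rung (crux r5) — NOT summit progress; nothing here decides a route item (r5 lets `R` grow as `ε ↓ 0`).

* The `ε`-rung `ARungAt δ ε R`: a pair-splitting rule read at radius `R` whose weighted site energy is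
  `≥ e_∞ − ε` at every site of every finite `δ`-separated configuration; crux r5 is "every `(δ, ε)` has an
  `ε`-rung" (`approxFiniteRangeSplitting_iff_arung`), `ARungAt δ 0 R ↔ RungAt δ R`, and the `ε`-rungs are
  monotone in `ε`, `R` and `δ`.
* Inversion averaging and STAR FORCING survive the slack verbatim: an `ε`-rung at `(δ, R)` forces
  `e_∞ − ε ≤ ½ Σ_j V(r_ij)` at every site with midpoint-symmetric bond patterns, in particular at every site of
  every `δ`-separated configuration when `R < δ` (`twoConeB_sub_le_half_sum`).  So a deep site does not refute the
  `ε`-rung but PRICES it: `ε ≥ B − ½ Σ_j V(r_ij)` with `B = -0.786477224` the tree's two-cone bound (unconditional).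
* INSTANCES (the quantitative content of the two stars of `…RadiusLadderStars`):
  `eps_ge_of_arungAt_five_sixths : δ ≤ 5/6 → R < 5/6 → ARungAt δ ε R → 1/200 ≤ ε` (Star21) and
  **`eps_ge_of_arungAt_23_25 : δ ≤ 23/25 → R < 23/25 → ARungAt δ ε R → 1401023/500000000 ≤ ε`** (Star959;
  `1401023/5·10⁸ = 2.802046e-3 = B − (−0.78927927)` exactly).  Read back on crux r5: every witness `(R, Φ)` of
  `ApproxFiniteRangeSplitting` at a hard core `δ ≤ 23/25 = 0.947·a` and tolerance `ε < 2.802e-3` has `R ≥ 23/25`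
  (`radius_ge_23_25_of_afeasible`) — the lane's table "U3" (`UNCONDITIONAL.md`) at `R = 0.92` as a kernel theorem.
-/

noncomputable section

namespace Summit.AtomisticToContinuum.Crystallization.Theorems.StrictSplittingRuleBirth

open scoped BigOperators Classical
open Literature.MathematicalPhysics.StatisticalMechanics

/-- Euclidean `3`-space. -/
local notation "E3" => EuclideanSpace ℝ (Fin 3)

/-! ## The `ε`-rung and its ladder -/

/-- `ε`-feasibility of a rule read at radius `R` on `δ`-separated configurations: weighted site energy
`≥ e_∞ − ε` everywhere. [folklore] -/
def AFeasible (δ ε R : ℝ) (Φ : E3 → Finset E3 → ℝ) : Prop :=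
  ∀ (N : ℕ) (x : Fin N → E3), Sep δ x → ∀ i : Fin N, eInf - ε ≤ siteE R Φ x i

/-- The `ε`-rung `S_R(δ, ε)`: some pair-splitting rule read at radius `R` is `ε`-feasible at hard core `δ`.
[folklore] -/
def ARungAt (δ ε R : ℝ) : Prop := ∃ Φ : E3 → Finset E3 → ℝ, IsRule Φ ∧ AFeasible δ ε R Φ

/-- Crux r5 is "every hard core and tolerance has an `ε`-rung". -/
theorem approxFiniteRangeSplitting_iff_arung :
    Summit.AtomisticToContinuum.Crystallization.Theses.FreeSplittingCertificates.ApproxFiniteRangeSplitting ↔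
      ∀ δ : ℝ, 0 < δ → ∀ ε : ℝ, 0 < ε → ∃ R : ℝ, 0 < R ∧ ARungAt δ ε R := by
  have h0 :
      Summit.AtomisticToContinuum.Crystallization.Theses.FreeSplittingCertificates.ApproxFiniteRangeSplitting ↔
        ∀ δ : ℝ, 0 < δ → ∀ ε : ℝ, 0 < ε →
          ∃ (R : ℝ) (Φ : E3 → Finset E3 → ℝ), 0 < R ∧ IsRule Φ ∧ AFeasible δ ε R Φ :=
    Iff.rfl
  rw [h0]
  refine forall₂_congr fun δ _ => forall₂_congr fun ε _ => ⟨?_, ?_⟩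
  · rintro ⟨R, Φ, hR, hrule, hfeas⟩
    exact ⟨R, hR, Φ, hrule, hfeas⟩
  · rintro ⟨R, hR, Φ, hrule, hfeas⟩
    exact ⟨R, Φ, hR, hrule, hfeas⟩

/-- At `ε = 0` the `ε`-rung is the rung. -/
theorem arungAt_zero_iff (δ R : ℝ) : ARungAt δ 0 R ↔ RungAt δ R := by
  simp only [ARungAt, RungAt, AFeasible, Feasible, sub_zero]

/-- A feasible rule is `ε`-feasible for every `ε ≥ 0`. -/
theorem afeasible_of_feasible {δ ε R : ℝ} (hε : 0 ≤ ε) {Φ : E3 → Finset E3 → ℝ} (hf : Feasible δ R Φ) :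
    AFeasible δ ε R Φ := fun N x hx i => by
  have h := hf N x hx i
  linarith

/-- A rung is an `ε`-rung for every `ε ≥ 0` (the second conjunct of `Ladder`, rung by rung). -/
theorem arungAt_of_rungAt {δ ε R : ℝ} (hε : 0 ≤ ε) : RungAt δ R → ARungAt δ ε R := by
  rintro ⟨Φ, hr, hf⟩
  exact ⟨Φ, hr, afeasible_of_feasible hε hf⟩

/-- **The ladder in the tolerance.** -/
theorem arungAt_mono_eps {δ ε ε' R : ℝ} (hε : ε ≤ ε') : ARungAt δ ε R → ARungAt δ ε' R := by
  rintro ⟨Φ, hr, hf⟩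
  refine ⟨Φ, hr, fun N x hx i => ?_⟩
  have h := hf N x hx i
  linarith

/-- **The ladder in the radius** (truncate and read at the larger radius). -/
theorem arungAt_mono_radius {δ ε R R' : ℝ} (hRR' : R ≤ R') : ARungAt δ ε R → ARungAt δ ε R' := by
  rintro ⟨Φ, hr, hf⟩
  refine ⟨truncate R Φ, isRule_truncate hr, fun N x hx i => ?_⟩
  rw [siteE_truncate hRR']
  exact hf N x hx i

/-- **The ladder in the hard core.** -/
theorem arungAt_mono_sep {δ δ' ε R : ℝ} (hδ : δ ≤ δ') : ARungAt δ ε R → ARungAt δ' ε R := by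
  rintro ⟨Φ, hr, hf⟩
  exact ⟨Φ, hr, fun N x hx i => hf N x (fun a b hab => hδ.trans (hx a b hab)) i⟩

/-! ## Inversion averaging and star forcing with slack -/

/-- Inversion averaging is free for `ε`-feasibility too. -/
theorem afeasible_invAvg {δ ε R : ℝ} {Φ : E3 → Finset E3 → ℝ} (hf : AFeasible δ ε R Φ) :
    AFeasible δ ε R (invAvg Φ) := by
  intro N x hx i
  rw [siteE_invAvg]
  have h1 := hf N x hx i
  have h2 := hf N (fun k => -x k) (sep_neg hx) i
  linarith

/-- **Star forcing with slack.**  An `ε`-rung at `(δ, R)` (`0 < δ`) forces `e_∞ − ε ≤ ½ Σ_j V(r_ij)` at every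
site of every `δ`-separated configuration all of whose bond patterns are midpoint-symmetric. -/
theorem eInf_sub_le_half_sum_of_symmetric {δ ε R : ℝ} (hδ : 0 < δ) (hrung : ARungAt δ ε R) {N : ℕ}
    (x : Fin N → E3) (hx : Sep δ x) (i : Fin N)
    (hsym : ∀ j, j ≠ i → (bondPattern R x i j).image (fun u => (x j - x i) - u) = bondPattern R x i j) :
    eInf - ε ≤ (∑ j ∈ Finset.univ.erase i, lennardJones (dist (x i) (x j))) / 2 := by
  obtain ⟨Φ, hr, hf⟩ := hrung
  have h := afeasible_invAvg hf N x hx i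
  rw [perturbative_siteE_eq] at h
  have hterm : ∀ j ∈ Finset.univ.erase i,
      invAvg Φ (x j - x i) (bondPattern R x i j) * lennardJones (dist (x i) (x j)) =
        lennardJones (dist (x i) (x j)) / 2 := by
    intro j hj
    have hji : j ≠ i := Finset.ne_of_mem_erase hj
    have hv : x j - x i ≠ 0 := by
      intro h0
      have hd := hx j i hji
      rw [dist_eq_norm, h0, norm_zero] at hd
      linarith
    rw [invAvg_eq_half hr hv (hsym j hji)]
    ring
  rw [Finset.sum_congr rfl hterm, ← Finset.sum_div] at h
  exact h

/-- **A deep site prices every pair-radius `ε`-rung**: if `R < δ` then an `ε`-rung at `(δ, R)` forces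
`B − ε ≤ ½ Σ_j V(r_ij)` at every site of every `δ`-separated configuration (`B` the tree's two-cone bound),
i.e. `ε ≥ B − ½ Σ_j V(r_ij)`; unconditional. -/
theorem twoConeB_sub_le_half_sum {δ ε R : ℝ} (hδ : 0 < δ) (hR : R < δ) {N : ℕ} (x : Fin N → E3)
    (hx : Sep δ x) (i : Fin N) (hrung : ARungAt δ ε R) :
    twoConeB - ε ≤ (∑ j ∈ Finset.univ.erase i, lennardJones (dist (x i) (x j))) / 2 := by
  have h := eInf_sub_le_half_sum_of_symmetric hδ hrung x hx i fun _ hj => bondPattern_of_lt_sep hR hx hj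
  linarith [twoConeB_le_eInf]

/-! ## Instances: the price of the two stars -/

namespace Star21

/-- Quantitative centre bound of `Star21`: half pair-sum `= 10·V(1.04300…) ≤ -0.7918`. -/
theorem centre_half_sum_le :
    (∑ j ∈ Finset.univ.erase (0 : Fin 21), lennardJones (dist (conf 0) (conf j))) / 2 ≤ -(7918 / 10000) := by
  have h : ∀ j ∈ Finset.univ.erase (0 : Fin 21),
      lennardJones (dist (conf 0) (conf j)) = lennardJones (Real.sqrt (108785141 / 10000 ^ 2)) := by
    intro j hj
    rw [dist_centre j (Finset.ne_of_mem_erase hj)]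
  rw [Finset.sum_congr rfl h, Finset.sum_const, Finset.card_erase_of_mem (Finset.mem_univ _),
    Finset.card_univ, Fintype.card_fin, lennardJones_sqrt (by positivity)]
  norm_num

end Star21

/-- **Price of a pair-radius `ε`-rung at hard core `≤ 5/6`**: `ε ≥ 1/200` (Star21: `B + 0.7918 = 5.32e-3 ≥ 5e-3`). -/
theorem eps_ge_of_arungAt_five_sixths : ∀ δ ε R : ℝ, δ ≤ 5 / 6 → R < 5 / 6 → ARungAt δ ε R → 1 / 200 ≤ ε := by
  intro δ ε R hδ hR hrung
  have h := twoConeB_sub_le_half_sum (by norm_num) hR Star21.conf Star21.sep_conf 0 (arungAt_mono_sep hδ hrung)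
  have hc := Star21.centre_half_sum_le
  unfold twoConeB at h
  linarith

namespace Star959

/-- Quantitative centre bound of `Star959`: half pair-sum `≤ -1578558540/(2·10⁹) = -0.78927927` (from the certified
energy rows `term_le` and `sum_b`). -/
theorem centre_half_sum_le :
    (∑ j ∈ Finset.univ.erase i0, lennardJones (dist (conf i0) (conf j))) / 2 ≤ -(78927927 / 10 ^ 8) := by
  have h0 : lennardJones (dist (conf i0) (conf i0)) = 0 := by
    rw [dist_self]
    norm_num [lennardJones]
  rw [Finset.sum_erase Finset.univ (f := fun j => lennardJones (dist (conf i0) (conf j))) h0]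
  have hle : ∑ j : Fin pts.length, lennardJones (dist (conf i0) (conf j)) ≤
      ∑ j : Fin pts.length, -((bOf (isq ctr pts[j.1]) : ℝ) / 10 ^ 9) :=
    Finset.sum_le_sum fun j _ => term_le (List.getElem_mem j.2)
  have hsum : ∑ j : Fin pts.length, -((bOf (isq ctr pts[j.1]) : ℝ) / 10 ^ 9) =
      -(((pts.map fun a => bOf (isq ctr a)).sum : ℕ) : ℝ) / 10 ^ 9 := by
    rw [← Fin.sum_univ_fun_getElem, Nat.cast_sum, Finset.sum_neg_distrib, ← Finset.sum_div, neg_div]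
  rw [hsum, sum_b] at hle
  push_cast at hle
  linarith

end Star959

/-- **Price of a pair-radius `ε`-rung at hard core `≤ 23/25`**: `ε ≥ 1401023/500000000 = 2.802046e-3`
(`= B − (−0.78927927)` exactly; Star959 = the lane's certified star `R_23o25`).  Unconditional. -/
theorem eps_ge_of_arungAt_23_25 :
    ∀ δ ε R : ℝ, δ ≤ 23 / 25 → R < 23 / 25 → ARungAt δ ε R → 1401023 / 500000000 ≤ ε := by
  intro δ ε R hδ hR hrung
  have h := twoConeB_sub_le_half_sum (by norm_num) hR Star959.conf Star959.sep_conf Star959.i0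
    (arungAt_mono_sep hδ hrung)
  have hc := Star959.centre_half_sum_le
  unfold twoConeB at h
  linarith

/-- Read back on crux r5: every witness `(R, Φ)` of `ApproxFiniteRangeSplitting` at a hard core `δ ≤ 23/25`
(`= 0.947·a`) and tolerance `ε < 2.802046e-3` has pattern radius `R ≥ 23/25`. -/
theorem radius_ge_23_25_of_afeasible {δ ε R : ℝ} (hδ : δ ≤ 23 / 25) (hε : ε < 1401023 / 500000000)
    {Φ : E3 → Finset E3 → ℝ} (hr : IsRule Φ) (hf : AFeasible δ ε R Φ) : 23 / 25 ≤ R :=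
  not_lt.mp fun hR => absurd (eps_ge_of_arungAt_23_25 δ ε R hδ hR ⟨Φ, hr, hf⟩) (not_le.mpr hε)

end Summit.AtomisticToContinuum.Crystallization.Theorems.StrictSplittingRuleBirth

end
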